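import Mathlib
import Literature.Analysis.PDE.InverseSquareTailFarChannels
import Literature.Analysis.PDE.FarChannelTranslation
import Literature.Geometry.Lorentzian.ReggeWheelerTortoise
import Summits.FinalStateConjecture.FinalStateConjecture.Theorems.PhotonSphereChannelsTortoise
import Summits.FinalStateConjecture.FinalStateConjecture.Theorems.PhotonSphereChannelsFarPotential

/-!
# Route PhotonSphereChannels — the FAR half-line channel estimate, modes `ℓ ≥ 1`

Item stmt-FinalStateConjecture-10048 (`FixedModeChannels`). The second hypothesis `hfar` of
`Theorems.fixedModeChannels_of_near_far` (the one-ended exterior channel inequality on the far cone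
`{x > xc + ρ + |t|}` for the spin-`s` Regge–Wheeler equation, per mode), VERBATIM, for all modes
with `ℓ ≥ 1` (`farHalfLineChannels_pos`). Proof: all tortoise radius functions are translates of the
canonical one `r₀` (`IsTortoiseRadius.unique`, `.comp_sub_add`); centred at
`x₀ = xc − r*(3M)` the Regge–Wheeler potential is inverse-square with an `O(y^{−5/2})` tail
(`Theorems.abs_rwPotential_tortoise_sub_inverseSquare_le`, `1 + log y ≤ 3√y`), so the centred far
channel estimate `Literature.Analysis.PDE.farChannels_of_inverseSquareTail` (true t-polynomial
kernel via corrected chains and towers, exact inverse-square channel inequality, Duhamel comparison,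
kernel transfer and frame bounds, absorption) applies to `Ṽ(y) = V(x₀ + y)` with `(ρ₀, c)` depending
only on `(M, s, ℓ)`, and `Literature.Analysis.PDE.farChannel_translate` moves the edge back to
`xc + ρ`. The mode `ℓ = 0` (`s = 0`; potential `2M(1−2M/r)/r³`, no inverse-square part) is the
mirror image of the near side and is not covered here.
-/

noncomputable section

namespace Summit.FinalStateConjecture.FinalStateConjecture.Theorems

open MeasureTheory Set Filter Topology Literature.Analysis.PDE
  Literature.Geometry.Lorentzian.ReggeWheeler Literature.Barriers.FinalStateConjecture

/-- `1 + log y ≤ 3 √y` for `y ≥ 1`. -/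
theorem one_add_log_le_three_mul_sqrt {y : ℝ} (hy : 1 ≤ y) : 1 + Real.log y ≤ 3 * Real.sqrt y := by
  have hy0 : 0 < y := by linarith
  have h1 : Real.log y ≤ 2 * Real.sqrt y := by
    have h := Real.log_le_sub_one_of_pos (Real.sqrt_pos.2 hy0)
    rw [Real.log_sqrt hy0.le] at h
    linarith [Real.sqrt_nonneg y]
  have h2 : 1 ≤ Real.sqrt y := by
    rw [show (1 : ℝ) = Real.sqrt 1 by simp]
    exact Real.sqrt_le_sqrt hy
  linarith

/-- **The far half-line channel estimate for `ℓ ≥ 1`** — hypothesis `hfar` of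
`fixedModeChannels_of_near_far`, verbatim after `s ≤ ℓ`, under the extra assumption `1 ≤ ℓ`. -/
theorem farHalfLineChannels_pos (M : ℝ) (hM : 0 < M) (s ℓ : ℕ) (hs : s ≤ 2) (hsℓ : s ≤ ℓ)
    (hℓ : 1 ≤ ℓ) :
    ∃ ρ₀ : ℝ, 0 ≤ ρ₀ ∧ ∃ c : ℝ, 0 < c ∧ ∀ (r : ℝ → ℝ) (xc : ℝ), (∀ x, 2 * M < r x) → (∀ x, HasDerivAt r (1 - 2 * M / r x) x) → r xc = 3 * M → ∀ ρ : ℝ, ρ₀ ≤ ρ → ∀ ψ : ℝ → ℝ → ℝ, ContDiff ℝ 2 (Function.uncurry ψ) → let V : ℝ → ℝ := fun x => (1 - 2 * M / r x) * ((ℓ : ℝ) * ((ℓ : ℝ) + 1) / r x ^ 2 + (1 - (s : ℝ) ^ 2) * (2 * M) / r x ^ 3); let e : (ℝ → ℝ → ℝ) → ℝ → ℝ → ℝ := fun φ t x => deriv (fun τ => φ τ x) t ^ 2 + deriv (φ t) x ^ 2 + V x * φ t x ^ 2; let IsSol : (ℝ → ℝ → ℝ) → ℝ × ℝ → Prop :=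 fun φ z => iteratedDeriv 2 (fun τ => φ τ z.2) z.1 - iteratedDeriv 2 (φ z.1) z.2 + V z.2 * φ z.1 z.2 = 0; let Ω : Set (ℝ × ℝ) := {z | xc + ρ + |z.1| < z.2}; let P : Set (ℝ → ℝ → ℝ) := {p | ContDiffOn ℝ 2 (Function.uncurry p) Ω ∧ (∀ z ∈ Ω, IsSol p z) ∧ ∃ (N : ℕ) (a : ℕ → ℝ → ℝ), ∀ z ∈ Ω, p z.1 z.2 = ∑ i ∈ Finset.range N, a i z.2 * z.1 ^ i}; let Eext : ℝ → ENNReal := fun t => MeasureTheory.lintegral (MeasureTheory.volume.restrict (Set.Ioi (xc + ρ + |t|))) (fun x => ENNReal.ofReal (e ψ t x)); (∀ z, IsSol ψ z) → ENNReal.ofReal c * (⨅ p ∈ P, MeasureTheory.lintegral (MeasureTheory.volume.restrict (Set.Ioi (xc + ρ))) (fun x => ENNReal.ofReal (e (fun t y => ψ t y - p t y) 0 x))) ≤ Filter.liminf Eext Filter.atTop + Filter.liminf Eext Filter.atBot := by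
  -- the canonical tortoise function and the centred potential
  obtain ⟨r₀, hr₀, hr₀', hr₀c⟩ := tortoise_exists M hM 0
  have h₀ : IsTortoiseRadius M r₀ 0 := isTortoiseRadius_iff.2 ⟨hr₀, hr₀', hr₀c⟩
  set rs : ℝ := efTortoiseCoord M (3 * M) with hrs
  set Vt : ℝ → ℝ := fun y => (1 - 2 * M / r₀ (y - rs)) * ((ℓ : ℝ) * ((ℓ : ℝ) + 1) / r₀ (y - rs) ^ 2
    + (1 - (s : ℝ) ^ 2) * (2 * M) / r₀ (y - rs) ^ 3) with hVt
  have hr₀c' : Continuous r₀ := continuous_iff_continuousAt.2 fun x => (hr₀' x).continuousAt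
  have hr₀0 : ∀ x, r₀ x ≠ 0 := fun x => (lt_trans (by positivity) (hr₀ x)).ne'
  have hsub : Continuous fun y : ℝ => y - rs := continuous_id.sub continuous_const
  have hVtc : Continuous Vt :=
    (continuous_const.sub (continuous_const.div (hr₀c'.comp hsub) fun y => hr₀0 _)).mul
      ((continuous_const.div ((hr₀c'.comp hsub).pow 2) fun y => pow_ne_zero 2 (hr₀0 _)).add
        (continuous_const.div ((hr₀c'.comp hsub).pow 3) fun y => pow_ne_zero 3 (hr₀0 _)))
  have hVt0 : ∀ y, 0 ≤ Vt y := fun y => rwPotential_nonneg hM (hr₀ _) hs hsℓ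
  -- the inverse-square tail
  set y₀ : ℝ := max 1 (64 * M ^ 2 + 2 * M + 1)
  have hy₀1 : 1 ≤ y₀ := le_max_left _ _
  have hVb : ∀ y, y₀ ≤ y → |Vt y - ℓ * (ℓ + 1) / y ^ 2|
      ≤ (48 * M * ((ℓ : ℝ) * ((ℓ : ℝ) + 1) + 3)) * y ^ (-(5 / 2 : ℝ)) := by
    intro y hy
    have hy1 : 1 ≤ y := hy₀1.trans hy
    have hyp : 0 < y := by linarith
    have hx : 64 * M ^ 2 + 2 * M + 1 ≤ (y - rs) - (0 - efTortoiseCoord M (3 * M)) := by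
      have := (le_max_right _ _ : 64 * M ^ 2 + 2 * M + 1 ≤ y₀).trans hy
      simp only [hrs]; linarith
    have h := abs_rwPotential_tortoise_sub_inverseSquare_le hM hr₀ hr₀' hr₀c hs ℓ hx
    have e : y - rs - (0 - efTortoiseCoord M (3 * M)) = y := by simp only [hrs]; ring
    rw [e] at h
    refine h.trans ?_
    have hlog := one_add_log_le_three_mul_sqrt hy1
    have hsq : Real.sqrt y / y ^ 3 = y ^ (-(5 / 2 : ℝ)) := by
      rw [Real.sqrt_eq_rpow, ← Real.rpow_natCast y 3, ← Real.rpow_sub hyp]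
      norm_num
    have hy3 : 0 < y ^ 3 := by positivity
    calc 16 * M * ((ℓ : ℝ) * ((ℓ : ℝ) + 1) + 3) * (1 + Real.log y) / y ^ 3
        ≤ 16 * M * ((ℓ : ℝ) * ((ℓ : ℝ) + 1) + 3) * (3 * Real.sqrt y) / y ^ 3 := by
          gcongr
      _ = (48 * M * ((ℓ : ℝ) * ((ℓ : ℝ) + 1) + 3)) * (Real.sqrt y / y ^ 3) := by ring
      _ = (48 * M * ((ℓ : ℝ) * ((ℓ : ℝ) + 1) + 3)) * y ^ (-(5 / 2 : ℝ)) := by rw [hsq]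
  -- the centred estimate
  obtain ⟨ρ₀, -, c, hc, H⟩ := farChannels_of_inverseSquareTail ℓ hℓ hVtc hVt0 hy₀1 hVb
  refine ⟨max 0 (ρ₀ - rs), le_max_left _ _, c, hc, ?_⟩
  intro r xc hr hr' hxc ρ hρ ψ hψ V e IsSol Ω P Eext hsol
  -- `r` is a translate of `r₀`
  have hrt : IsTortoiseRadius M r xc := isTortoiseRadius_iff.2 ⟨hr, hr', hxc⟩
  have hr_eq : r = fun x => r₀ (x - xc + 0) := hrt.unique (h₀.comp_sub_add xc)
  -- the translation `x = d + y`, `d = xc − r*(3M)`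
  set d : ℝ := xc - rs with hd
  have hVtr : ∀ y, Vt y = V (d + y) := by
    intro y
    have hry : r (d + y) = r₀ (y - rs) := by
      rw [hr_eq]
      show r₀ (d + y - xc + 0) = r₀ (y - rs)
      congr 1
      simp only [hd]; ring
    show Vt y = (1 - 2 * M / r (d + y)) * ((ℓ : ℝ) * ((ℓ : ℝ) + 1) / r (d + y) ^ 2
      + (1 - (s : ℝ) ^ 2) * (2 * M) / r (d + y) ^ 3)
    rw [hry]
  -- the translated solution solves the `Vt`-equation
  have hψtC : ContDiff ℝ 2 (Function.uncurry fun t y => ψ t (d + y)) :=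
    hψ.comp (contDiff_fst.prodMk (contDiff_const.add contDiff_snd))
  have hψtsol : ∀ t y, iteratedDeriv 2 (fun τ => ψ τ (d + y)) t
      - iteratedDeriv 2 (fun y => ψ t (d + y)) y + Vt y * ψ t (d + y) = 0 := by
    intro t y
    have h := hsol (t, d + y)
    have e1 : iteratedDeriv 2 (fun y => ψ t (d + y)) y = iteratedDeriv 2 (ψ t) (d + y) := by
      rw [iteratedDeriv_comp_const_add 2 (ψ t) d]
    rw [e1, hVtr y]
    exact h
  -- the centred estimate at the edge `ρ + r*(3M)`, translated back to `xc + ρ`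
  have hρ' : ρ₀ ≤ ρ + rs := by
    have := (le_max_right _ _ : ρ₀ - rs ≤ max 0 (ρ₀ - rs)).trans hρ
    linarith
  have Hc := H (ρ + rs) hρ' (fun t y => ψ t (d + y)) hψtC hψtsol
  have HT := farChannel_translate (V := V) (Vt := Vt) (ψ := ψ) (d := d) (ρ := ρ + rs) (c := c)
    hVtr Hc
  have ed : d + (ρ + rs) = xc + ρ := by simp only [hd]; ring
  rw [ed] at HT
  exact HT

end Summit.FinalStateConjecture.FinalStateConjecture.Theorems
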